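import Literature.NumberTheory.EllipticCurves.PAdicOneVariableDilationOfComparison
import Literature.NumberTheory.EllipticCurves.PAdicOneVariableUnitsSocket
import HarnessLib

/-!
# `p = 2`: the U_0-EQUIVARIANCE input of the measure-side recipe, from the Coleman relation
# `h_{σβ} = κ(σ) · (h_β ∘ [κσ]_{f'})` transported by `ϑ`: `ν_{σβ} = κ(σ)·(κ(σ)_* ν_β)` and
# `ν_{σβ}♭(κ(σ) b) = ν_β♭(b)` on the unit cells

Topic `NumberTheory/EllipticCurves`; namespace `Literature.NumberTheory.EllipticCurves`.

De Shalit, *Iwasawa theory of elliptic curves with complex multiplication* (1987), I.3.4 Lemma (ii) (p. 18):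
`μ_{γ(β)}(γU) = μ_β(U)`, from I.2.3 (iv) `g_{σβ} = g_β ∘ [κσ]_f` and the chain rule for the log-free series
`h = D log̃ g`: `h_{σβ} = κ(σ) · (h_β ∘ [κσ]_{f'})` (cf2c-w7 `logDeriv_eq_of_eq_subst_hom`).  With the dilation
transport of `PAdicOneVariableDilationOfComparison.lean` (`Θ((h ∘ [a]) ∘ ϑ) = binomDilate (e a) (Θ(h ∘ ϑ))`)
and the measure side's `invAmice₁_smul_μ` / `invAmice₁_binomDilate_μ` /
`restrictUnits_density_unitInv_μ_of_μ_eq_mul_mulUnit` (files `PAdicOneVariableDilation/UnitsSocket.lean`):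

* ★★ `invAmice₁_μ_of_eq_C_mul_subst_homC'` — if `h₂ = a · (h₁ ∘ [a]_{f'})` in `𝒪̂_{F^nr}⟦X⟧` then, for
  `H_i := Θ(h_i ∘ ϑ)` and `v = e a ∈ ℤ_2^×`: **`D_{H₂} = v · (v_* D_{H₁})`** levelwise — the hypothesis `hνν'`
  of `restrictUnits_density_unitInv_μ_of_μ_eq_mul_mulUnit` VERBATIM;
* ★★★ `restrictUnits_density_unitInv_μ_unitMul_of_eq_C_mul_subst_homC'` — hence
  **`ν₂♭(v̄ b) = ν₁♭(b)`** for the unit-ball measures `ν_i♭ := restrictUnits (x⁻¹ · D_{H_i})`: the hypothesis `hν`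
  of the U_0-equivariance `GroupDistribution.comap_family_equivariant(_of_character)` (DIVISION-STEP §2(a):
  `ν_{hβ}♭(τ_h b) = ν_β♭(b)` with `τ_h = unitMul (unitMod (n+1) (κ h))`).

Everything is proved; no named facts, no definitions, no instances, no `sorry`.

## References

* [deShalit1987] E. de Shalit, *Iwasawa theory of elliptic curves with complex multiplication* (1987),
  I.2.3 (iv) (p. 14), I.3.4 Lemma (ii) (p. 18), II.4.5 (iv), II.4.6 (14) (p. 59).
-/

noncomputable section

open MvPowerSeries

namespace Literature.NumberTheory.EllipticCurves

section EquivarianceOfComparison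

open ValuativeRel IsLocalRing Field
open Literature.NumberTheory.GaloisRepresentations Literature.NumberTheory.GaloisRepresentations.IsNonarchimedeanLocalField
  Literature.NumberTheory.GaloisRepresentations.LubinTate Literature.NumberTheory.PAdicHodge

variable {F : Type} [Field F] [ValuativeRel F] [TopologicalSpace F] [IsNonarchimedeanLocalField F]
variable (hq : residueFieldCard F = 2) (h2 : (valuation F).IsUniformizer (((2 : ℕ) : 𝒪[F]) : F))
  {σ₀ : absoluteGaloisGroup F} (hσ₀ : IsAbsArithFrob σ₀) (u : 𝒪[F]ˣ)
  {ε : (maxUnramifiedCompletion F)ˣ}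
  (hε : maxUnramifiedCompletion.galAut F σ₀ (ε : maxUnramifiedCompletion F) =
    algebraMap 𝒪[F] (maxUnramifiedCompletion F) (u : 𝒪[F]) * (ε : maxUnramifiedCompletion F))
variable {𝕜 : Type*} [NormedField 𝕜] [NormedAlgebra ℚ_[2] 𝕜] [IsUltrametricDist 𝕜] [CompleteSpace 𝕜]
  (Θ : UnrCoeff F →+* 𝕜) (e : 𝒪[F] →+* ℤ_[2]) (hΘe : ∀ a : 𝒪[F], Θ (intToUnrCoeff F a) = padicIntCast 𝕜 (e a))

omit [IsUltrametricDist 𝕜] [CompleteSpace 𝕜] in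
include hq hΘe in
/-- `Θ((a · (h ∘ [a]_{f'})) ∘ ϑ) = Θ(a) • binomDilate (e a) (Θ(h ∘ ϑ))`. [cite: deShalit1987, I.3.4 Lemma (ii) (p. 18)] -/
theorem map_subst_compSeriesC_C_mul_subst_homC' (a : 𝒪[F]) (h : PowerSeries (UnrCoeff F)) :
    (PowerSeries.subst (compSeriesC h2 hσ₀ u hε)
        (PowerSeries.C (intToUnrCoeff F a) * PowerSeries.subst (homC' h2 u a) h)).map Θ =
      padicIntCast 𝕜 (e a) • binomDilate (e a) ((PowerSeries.subst (compSeriesC h2 hσ₀ u hε) h).map Θ) := by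
  have hs : PowerSeries.HasSubst (compSeriesC h2 hσ₀ u hε) :=
    PowerSeries.HasSubst.of_constantCoeff_zero' (constantCoeff_compSeriesC h2 hσ₀ u hε)
  rw [PowerSeries.subst_mul hs, PowerSeries.subst_C, map_mul,
    map_subst_compSeriesC_subst_homC'_eq_binomDilate hq h2 hσ₀ u hε Θ e hΘe a h, PowerSeries.smul_eq_C_mul,
    ← hΘe a]
  congr 1
  exact PowerSeries.map_C Θ _

include hq hΘe in
/-- ★★ **`D_{H₂} = v · (v_* D_{H₁})` levelwise** when `h₂ = a · (h₁ ∘ [a]_{f'})` (`v = e a` a unit,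
`H_i = Θ(h_i ∘ ϑ)`): the hypothesis `hνν'` of `restrictUnits_density_unitInv_μ_of_μ_eq_mul_mulUnit` — de Shalit's
`μ_{σβ}(σU) = μ_β(U)` for the log-free measures (`ν = κμ`). [cite: deShalit1987, I.3.4 Lemma (ii) (p. 18)] -/
theorem invAmice₁_μ_of_eq_C_mul_subst_homC' (a : 𝒪[F]) (v : ℤ_[2]ˣ) (hv : (v : ℤ_[2]) = e a)
    (h₁ h₂ : PowerSeries (UnrCoeff F))
    (hh : h₂ = PowerSeries.C (intToUnrCoeff F a) * PowerSeries.subst (homC' h2 u a) h₁) {C : ℝ}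
    (hC₁ : ∀ k, ‖PowerSeries.coeff k ((PowerSeries.subst (compSeriesC h2 hσ₀ u hε) h₁).map Θ)‖ ≤ C)
    (hC₂ : ∀ k, ‖PowerSeries.coeff k ((PowerSeries.subst (compSeriesC h2 hσ₀ u hε) h₂).map Θ)‖ ≤ C)
    (n : ℕ) (c : ZMod (2 ^ n)) :
    (invAmice₁ 2 ((PowerSeries.subst (compSeriesC h2 hσ₀ u hε) h₂).map Θ) hC₂).μ n c =
      padicIntCast 𝕜 (v : ℤ_[2]) *
        ((invAmice₁ 2 ((PowerSeries.subst (compSeriesC h2 hσ₀ u hε) h₁).map Θ) hC₁).mulUnit v).μ n c := by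
  have key := map_subst_compSeriesC_C_mul_subst_homC' hq h2 hσ₀ u hε Θ e hΘe a h₁
  rw [← hh, ← hv] at key
  have hD : ∀ k, ‖PowerSeries.coeff k (binomDilate (v : ℤ_[2])
      ((PowerSeries.subst (compSeriesC h2 hσ₀ u hε) h₁).map Θ))‖ ≤ C :=
    norm_coeff_binomDilate_le hC₁ (v : ℤ_[2])
  have hC₂' : ∀ k, ‖PowerSeries.coeff k (padicIntCast 𝕜 (v : ℤ_[2]) • binomDilate (v : ℤ_[2])
      ((PowerSeries.subst (compSeriesC h2 hσ₀ u hε) h₁).map Θ))‖ ≤ C := by rw [← key]; exact hC₂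
  rw [invAmice₁_μ, key, ← invAmice₁_μ hC₂', invAmice₁_smul_μ hD _ hC₂', invAmice₁_binomDilate_μ hC₁ v n c]

include hq hΘe in
/-- ★★★ **`ν₂♭(v̄ b) = ν₁♭(b)` on the unit cells** for `ν_i♭ := restrictUnits (x⁻¹ · D_{Θ(h_i ∘ ϑ)})` when
`h₂ = a · (h₁ ∘ [a]_{f'})`, `v = e a`: the hypothesis `hν` of the U_0-equivariance
`GroupDistribution.comap_family_equivariant` of the measure-side recipe (`τ_h b = unitMul (unitMod (n+1) κ(h)) b`).
[cite: deShalit1987, I.3.4 Lemma (ii) (p. 18), II.4.6 (14) (p. 59)] -/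
theorem restrictUnits_density_unitInv_μ_unitMul_of_eq_C_mul_subst_homC' (a : 𝒪[F]) (v : ℤ_[2]ˣ)
    (hv : (v : ℤ_[2]) = e a) (h₁ h₂ : PowerSeries (UnrCoeff F))
    (hh : h₂ = PowerSeries.C (intToUnrCoeff F a) * PowerSeries.subst (homC' h2 u a) h₁) {C : ℝ}
    (hC₁ : ∀ k, ‖PowerSeries.coeff k ((PowerSeries.subst (compSeriesC h2 hσ₀ u hε) h₁).map Θ)‖ ≤ C)
    (hC₂ : ∀ k, ‖PowerSeries.coeff k ((PowerSeries.subst (compSeriesC h2 hσ₀ u hε) h₂).map Θ)‖ ≤ C)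
    (n : ℕ) (b : ZMod (2 ^ (n + 1))) :
    (restrictUnits ((invAmice₁ 2 ((PowerSeries.subst (compSeriesC h2 hσ₀ u hε) h₂).map Θ) hC₂).density
        (ProfiniteTower.padicInt_isUniform 2) (unitInv 𝕜) uniformContinuous_unitInv norm_unitInv_le)).μ n
        (BoundedDistribution.unitMul (BoundedDistribution.unitMod (n + 1) v) b) =
      (restrictUnits ((invAmice₁ 2 ((PowerSeries.subst (compSeriesC h2 hσ₀ u hε) h₁).map Θ) hC₁).density
        (ProfiniteTower.padicInt_isUniform 2) (unitInv 𝕜) uniformContinuous_unitInv norm_unitInv_le)).μ n b :=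
  restrictUnits_density_unitInv_μ_of_μ_eq_mul_mulUnit _ _ v
    (fun n c ↦ invAmice₁_μ_of_eq_C_mul_subst_homC' hq h2 hσ₀ u hε Θ e hΘe a v hv h₁ h₂ hh hC₁ hC₂ n c) n b

end EquivarianceOfComparison

end Literature.NumberTheory.EllipticCurves

end
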